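import Summits.KontsevichZagierPeriods.KontsevichZagierPeriods.Theorems.RootDecompZetaThreeFrontierWordMatchPreludeP8

/-! lens-1 g11 MatchPrelude.lean v7 @63f0e2cd §32–§43 (l.2275–4001): swap move + t₁-IBP engine, one-step lowering lemmas, §34–§36, the GapClassMatch PROCEDURE D1–D9 with measure μ, §37–§43 gap-world calculus (engine steps in gap coordinates, split rules, uniform evaluation on Δ₃°, ruleD6) — continuation P9+ of the census chain WordMatchPreludeP1–P8 (critic g4 CLEARED rows g4-29 / g4-38, A10/B10/C10). -/

/-! # `RootDecompZetaThreeFrontierWordMatchPreludeP9a` — part 1/2 of the mechanical ≤230-line split of `P9src.lean`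
(split by the decomp-kz census seat for landing; mathematics unchanged). -/

/-! # `RootDecompZetaThreeFrontierWordMatchPreludeP9` — part 1/6 of the mechanical ≤340-line split of `src.lean`
(split by the decomp-kz census seat for landing; mathematics unchanged). -/

set_option linter.dupNamespace false

-- BEGIN private-copy prelude (census splitter)
noncomputable section

namespace Summit.KontsevichZagierPeriods.RootDecompZetaThreeFrontier.WordLayer
open Set MeasureTheory Literature.NumberTheory.Transcendental
open Literature.ModelTheory.ExponentialFields (IsSemialgebraic)
open Summit.KontsevichZagierPeriods.KontsevichZagierPeriods.Theorems.RootDecompZetaThreeFrontierWordMoves (mem_simplex_two_iff mem_simplex_three_iff)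
/-! (private copy of `exists_measurableEquiv_snoc` — dedup.landed / split policy; origin part RootDecompZetaThreeFrontierWordMatchPreludeP7) -/
/-- Splitting off the last coordinate, `ℝ^{N+1} ≃ ℝ^N × ℝ`, as a volume-preserving measurable
equivalence with inverse `(x, t) ↦ Fin.snoc x t`. [folklore] (verbatim private copy) -/
private theorem exists_measurableEquiv_snoc (N : ℕ) :
    ∃ e : (Fin (N + 1) → ℝ) ≃ᵐ (Fin N → ℝ) × ℝ,
      MeasurePreserving e volume ((volume : Measure (Fin N → ℝ)).prod (volume : Measure ℝ)) ∧
      ∀ q, e.symm q = Fin.snoc q.1 q.2 := by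
  refine ⟨(MeasurableEquiv.piFinSuccAbove (fun _ => ℝ) (Fin.last N)).trans
    MeasurableEquiv.prodComm, ?_, fun q => ?_⟩
  · refine (volume_preserving_piFinSuccAbove (fun _ => ℝ) (Fin.last N)).trans ?_
    rw [Measure.volume_eq_prod]
    exact Measure.measurePreserving_swap
  · show (MeasurableEquiv.piFinSuccAbove (fun _ => ℝ) (Fin.last N)).symm (q.2, q.1) = _
    rw [MeasurableEquiv.piFinSuccAbove_symm_apply, Fin.insertNthEquiv_last]
    rfl
end Summit.KontsevichZagierPeriods.RootDecompZetaThreeFrontier.WordLayer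

namespace Summit.KontsevichZagierPeriods.RootDecompZetaThreeFrontier.WordLayer
open Set MeasureTheory Literature.NumberTheory.Transcendental
open Literature.ModelTheory.ExponentialFields (IsSemialgebraic)
open Summit.KontsevichZagierPeriods.KontsevichZagierPeriods.Theorems.RootDecompZetaThreeFrontierWordMoves (mem_simplex_two_iff mem_simplex_three_iff)
/-! (private copy of `newtonLeibniz_pack` — dedup.landed / split policy; origin part RootDecompZetaThreeFrontierWordMatchPreludeP7) -/
/-- **Newton–Leibniz over an open band, packaged.** Let `r` be a representation whose domain is
the open band `{(x, t) | x ∈ τ, a x < t < b x}` over a semialgebraic base `τ` with semialgebraic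
`a < b`, and whose integrand agrees there with `f`; let `F`, `f` be semialgebraic on the closed band;
suppose `t ↦ F (x, t)` is continuous on `[a x, b x]` with derivative `f (x, ·)` on `(a x, b x)`
for `x ∈ τ`. Then `[r] ≡ [τ, F (x, b x) − F (x, a x)]` modulo relations; the base integrand is
absolutely integrable by Fubini and the fundamental theorem of calculus.
[Kontsevich–Zagier 2001, §1.2, rule (3)] [folklore] (verbatim copy of
`Summit.KontsevichZagierPeriods.ArrangementNormalForm.JanusBands.IntegrateOut.newtonLeibniz_pack`) -/
private theorem newtonLeibniz_pack {N : ℕ} {τ : Set (Fin N → ℝ)} (hτ : IsSemialgebraic ℚ τ)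
    {a b : (Fin N → ℝ) → ℝ} (ha : IsSemialgebraicFunOn ℚ τ a) (hb : IsSemialgebraicFunOn ℚ τ b)
    (hab : ∀ x ∈ τ, a x < b x) {f F : (Fin (N + 1) → ℝ) → ℝ}
    (hf : IsSemialgebraicFunOn ℚ (KZlog.band τ a b) f)
    (hF : IsSemialgebraicFunOn ℚ (KZlog.band τ a b) F)
    (hcont : ∀ x ∈ τ, ContinuousOn (fun t => F (Fin.snoc x t)) (Icc (a x) (b x)))
    (hder : ∀ x ∈ τ, ∀ t ∈ Ioo (a x) (b x),
      HasDerivAt (fun s => F (Fin.snoc x s)) (f (Fin.snoc x t)) t)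
    (r : KZ.IntegralRep (N + 1))
    (hrd : r.domain = {z | (Fin.init z : Fin N → ℝ) ∈ τ ∧ a (Fin.init z) < z (Fin.last N) ∧
      z (Fin.last N) < b (Fin.init z)})
    (hri : EqOn r.integrand f r.domain) :
    ∃ r' : KZ.IntegralRep N, r'.domain = τ ∧
      (r'.integrand = fun x => F (Fin.snoc x (b x)) - F (Fin.snoc x (a x))) ∧
      KZ.of r - KZ.of r' ∈ KZ.relations := by
  have hτm : MeasurableSet τ := IsSemialgebraic.measurableSet_holds hτ
  have hBsa : IsSemialgebraic ℚ (KZlog.band τ a b) := KZlog.isSemialgebraic_band ha hb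
  have hBm : MeasurableSet (KZlog.band τ a b) := IsSemialgebraic.measurableSet_holds hBsa
  have hsub : r.domain ⊆ KZlog.band τ a b := by
    rw [hrd]; exact fun z hz => ⟨hz.1, hz.2.1.le, hz.2.2.le⟩
  have hdiff : KZlog.band τ a b \ r.domain ⊆
      {z | (Fin.init z : Fin N → ℝ) ∈ τ ∧ z (Fin.last N) = a (Fin.init z)} ∪
        {z | (Fin.init z : Fin N → ℝ) ∈ τ ∧ z (Fin.last N) = b (Fin.init z)} := by
    rw [hrd]
    rintro z ⟨⟨hzτ, h1, h2⟩, hz⟩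
    simp only [mem_setOf_eq, not_and, not_lt] at hz
    rcases h1.lt_or_eq with h1 | h1
    · exact Or.inr ⟨hzτ, le_antisymm h2 (hz hzτ h1)⟩
    · exact Or.inl ⟨hzτ, h1.symm⟩
  have hnull : volume (KZlog.band τ a b \ r.domain) = 0 :=
    measure_mono_null hdiff (measure_union_null (KZ.volume_graph_eq_zero ha)
      (KZ.volume_graph_eq_zero hb))
  have hfO : IntegrableOn f r.domain :=
    r.integrableOn.congr_fun hri (KZ.IntegralRep.measurableSet_domain_holds r)
  have hfB : IntegrableOn f (KZlog.band τ a b) := by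
    rw [← Set.union_sdiff_cancel hsub]
    exact integrableOn_union.mpr ⟨hfO, IntegrableOn.of_measure_zero hnull⟩
  let r₂ : KZ.IntegralRep (N + 1) := ⟨KZlog.band τ a b, f, hBsa, hf, hfB⟩
  have h12 : KZ.of r - KZ.of r₂ ∈ KZ.relations := by
    refine KZ.of_sub_of_mem_relations_of_null r r₂ ?_ hnull fun z hz => hri hz.1
    rw [Set.sdiff_eq_empty.mpr hsub, measure_empty]
  -- the base integrand and its semialgebraicity
  have hmap : ∀ {c : (Fin N → ℝ) → ℝ}, IsSemialgebraicFunOn ℚ τ c →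
      (∀ x ∈ τ, c x ∈ Icc (a x) (b x)) →
      IsSemialgebraicFunOn ℚ τ (fun x => F (Fin.snoc x (c x))) := by
    intro c hc hcm
    have hφ : IsSemialgebraicMapOn ℚ τ (fun x => (Fin.snoc x (c x) : Fin (N + 1) → ℝ)) := by
      refine IsSemialgebraicMapOn.of_forall hτ fun j => ?_
      refine Fin.lastCases ?_ (fun i => ?_) j
      · simpa using hc
      · simpa using isSemialgebraicFunOn_apply hτ i
    exact IsSemialgebraicFunOn.comp_isSemialgebraicMapOn_holds hF hφ
      fun x hx => KZlog.snoc_mem_band.mpr ⟨hx, hcm x hx⟩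
  have hgsa : IsSemialgebraicFunOn ℚ τ (fun x => F (Fin.snoc x (b x)) - F (Fin.snoc x (a x))) :=
    IsSemialgebraicFunOn.sub_holds (hmap hb fun x hx => Set.right_mem_Icc.mpr (hab x hx).le)
      (hmap ha fun x hx => Set.left_mem_Icc.mpr (hab x hx).le)
  -- integrability of the base integrand: Fubini and the fundamental theorem of calculus
  set G : (Fin (N + 1) → ℝ) → ℝ := (KZlog.band τ a b).indicator f with hG_def
  have hG : Integrable G := (integrable_indicator_iff hBm).mpr hfB
  obtain ⟨e, he, he_symm⟩ := exists_measurableEquiv_snoc N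
  have hG2 : Integrable (fun q : (Fin N → ℝ) × ℝ => G (Fin.snoc q.1 q.2))
      ((volume : Measure (Fin N → ℝ)).prod (volume : Measure ℝ)) := by
    have h := ((he.symm e).integrable_comp_emb e.symm.measurableEmbedding (g := G)).mpr hG
    convert h using 1
    ext q
    simp [he_symm]
  have hfib_in : ∀ x ∈ τ, (fun t => G (Fin.snoc x t)) =
      (Icc (a x) (b x)).indicator (fun t => f (Fin.snoc x t)) := by
    intro x hx
    ext t
    by_cases ht : t ∈ Icc (a x) (b x)
    · rw [indicator_of_mem ht, hG_def, indicator_of_mem (KZlog.snoc_mem_band.mpr ⟨hx, ht⟩)]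
    · rw [indicator_of_notMem ht, hG_def,
        indicator_of_notMem (fun h => ht (KZlog.snoc_mem_band.mp h).2)]
  have hgx : ∀ x ∈ τ, Integrable (fun t => G (Fin.snoc x t)) →
      F (Fin.snoc x (b x)) - F (Fin.snoc x (a x)) = ∫ t, G (Fin.snoc x t) := by
    intro x hx hxi
    rw [hfib_in x hx, integral_indicator measurableSet_Icc, integral_Icc_eq_integral_Ioc,
      ← intervalIntegral.integral_of_le (hab x hx).le]
    refine (intervalIntegral.integral_eq_sub_of_hasDerivAt_of_le (hab x hx).le (hcont x hx)
      (hder x hx) ?_).symm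
    rw [intervalIntegrable_iff_integrableOn_Icc_of_le (hab x hx).le]
    have h' := hxi
    rw [hfib_in x hx] at h'
    exact (integrable_indicator_iff measurableSet_Icc).mp h'
  have hgi : IntegrableOn (fun x => F (Fin.snoc x (b x)) - F (Fin.snoc x (a x))) τ := by
    refine Integrable.mono' hG2.integral_norm_prod_left.integrableOn.integrable
      (KZ.aestronglyMeasurable_of_isSemialgebraicFunOn hgsa hτm) ?_
    rw [ae_restrict_iff' hτm]
    filter_upwards [hG2.prod_right_ae] with x hx hxτ
    rw [hgx x hxτ hx]
    exact norm_integral_le_integral_norm _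
  let r' : KZ.IntegralRep N :=
    ⟨τ, fun x => F (Fin.snoc x (b x)) - F (Fin.snoc x (a x)), hτ, hgsa, hgi⟩
  have h23 : KZ.of r₂ - KZ.of r' ∈ KZ.relations :=
    KZ.newtonLeibnizRel_subset_relations ⟨N, r₂, r', a, b, F, hF, ha, hb,
      fun x hx => (hab x hx).le, rfl, hcont, hder, fun x _ => rfl, rfl⟩
  refine ⟨r', rfl, rfl, ?_⟩
  have : KZ.of r - KZ.of r' = (KZ.of r - KZ.of r₂) + (KZ.of r₂ - KZ.of r') := by abel
  rw [this]
  exact KZ.relations.add_mem h12 h23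
end Summit.KontsevichZagierPeriods.RootDecompZetaThreeFrontier.WordLayer

end
-- END private-copy prelude

noncomputable section

/-! # §32  THE SWAP MOVE `(t₀,t₁,t₂) ↦ (t₀,t₂,t₁)` AND THE t₁-IBP ENGINE (decomp-kz lens-1 gen 11).
Rule 2 with the coordinate swap maps `Δ₃` onto `Δ₃^sw = {1 > u₀ > u₂ > u₁ > 0}`, the open band `u₁ < u₂ < u₀` over `Δ₂`; Newton–Leibniz in the
(new) last coordinate integrates the ORIGINAL middle variable `t₁` from `t₂` to `t₀`.  For every `P ∈ ℚ[t₀,t₁,t₂]`: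
`[Δ₃, ibpQ1(P)/den(β₀,β₁+1,γ₁+1,γ₂,α)] ≡ [Δ₂, ibpB1(P)/(y₀^{β₀+β₁} y₁^{β₁} (1-y₀)^{γ₁} (1-y₁)^{γ₁+γ₂} (y₀-y₁)^α)] ∈ GZ₂`,
`ibpQ1 P β₁ γ₁ = ∂₁P·t₁(1-t₁) + P·(γ₁ t₁ - β₁ (1-t₁))`.  No boundary divergence can occur in this direction: all five denominator factors are
nonzero on the CLOSED band. -/

namespace Summit.KontsevichZagierPeriods.KontsevichZagierPeriods.Theorems.RootDecompZetaThreeFrontierWordMoves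

open Set MeasureTheory Literature.NumberTheory.Transcendental
open Summit.KontsevichZagierPeriods.RootDecompZetaThreeFrontier

section SwapMoveThree

open Literature.ModelTheory.ExponentialFields (IsSemialgebraic)

/-- the swap `(z₀,z₁,z₂) ↦ (z₀,z₂,z₁)` -/
def sw3 (z : Fin 3 → ℝ) : Fin 3 → ℝ := ![z 0, z 2, z 1]
/-- Auxiliary step `sw3_zero`. [bookkeeping] -/
theorem sw3_zero (z : Fin 3 → ℝ) : sw3 z 0 = z 0 := by simp [sw3]
/-- Auxiliary step `sw3_one`. [bookkeeping] -/
theorem sw3_one (z : Fin 3 → ℝ) : sw3 z 1 = z 2 := by simp [sw3]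
/-- Auxiliary step `sw3_two`. [bookkeeping] -/
theorem sw3_two (z : Fin 3 → ℝ) : sw3 z 2 = z 1 := by simp [sw3]
/-- Auxiliary step `sw3_sw3`. [bookkeeping] -/
theorem sw3_sw3 (z : Fin 3 → ℝ) : sw3 (sw3 z) = z := by
  funext i
  fin_cases i <;> simp [sw3_zero, sw3_one, sw3_two]

/-- the swap as a continuous linear map -/
def sw3L : (Fin 3 → ℝ) →L[ℝ] (Fin 3 → ℝ) := ContinuousLinearMap.pi ![Pj3 0, Pj3 2, Pj3 1]

/-- Auxiliary step `sw3_eq_L`. [bookkeeping] -/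
theorem sw3_eq_L (z : Fin 3 → ℝ) : sw3 z = sw3L z := by
  funext i
  fin_cases i <;> simp [sw3, sw3L]

/-- Auxiliary step `sw3L_sw3L`. [bookkeeping] -/
theorem sw3L_sw3L (w : Fin 3 → ℝ) : sw3L (sw3L w) = w := by
  rw [← sw3_eq_L, ← sw3_eq_L, sw3_sw3]

/-- Auxiliary step `hasFDerivAt_sw3`. [bookkeeping] -/
theorem hasFDerivAt_sw3 (x : Fin 3 → ℝ) : HasFDerivAt sw3 sw3L x := by
  have e : sw3 = fun z => sw3L z := funext sw3_eq_L
  rw [e]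
  exact sw3L.hasFDerivAt

/-- Auxiliary step `abs_det_sw3L`. [bookkeeping] -/
theorem abs_det_sw3L : |sw3L.det| = 1 := abs_det_of_invol sw3L_sw3L

/-- the swapped simplex `Δ₃^sw = {1 > u₀ > u₂ > u₁ > 0}` -/
def swapDom3 : Set (Fin 3 → ℝ) := {z | 0 < z 1 ∧ z 1 < z 2 ∧ z 2 < z 0 ∧ z 0 < 1}

/-- Auxiliary step `sw3_mem`. [bookkeeping] -/
theorem sw3_mem {z : Fin 3 → ℝ} (hz : z ∈ KZ.openOrderedSimplex 3) : sw3 z ∈ swapDom3 := by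
  rw [mem_simplex_three_iff] at hz
  obtain ⟨h2, h21, h10, h0⟩ := hz
  simp only [swapDom3, mem_setOf_eq, sw3_zero, sw3_one, sw3_two]
  exact ⟨h2, h21, h10, h0⟩

/-- Auxiliary step `sw3_mem'`. [bookkeeping] -/
theorem sw3_mem' {z : Fin 3 → ℝ} (hz : z ∈ swapDom3) : sw3 z ∈ KZ.openOrderedSimplex 3 := by
  obtain ⟨h1, h12, h20, h0⟩ := hz
  rw [mem_simplex_three_iff, sw3_zero, sw3_one, sw3_two]
  exact ⟨h1, h12, h20, h0⟩

/-- Auxiliary step `image_sw3`. [bookkeeping] -/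
theorem image_sw3 : sw3 '' KZ.openOrderedSimplex 3 = swapDom3 := by
  ext u
  constructor
  · rintro ⟨z, hz, rfl⟩; exact sw3_mem hz
  · intro hu; exact ⟨sw3 u, sw3_mem' hu, sw3_sw3 u⟩

/-- Auxiliary step `image_sw3'`. [bookkeeping] -/
theorem image_sw3' : sw3 '' swapDom3 = KZ.openOrderedSimplex 3 := by
  rw [← image_sw3, Set.image_image]
  simp [sw3_sw3]

/-- `swapDom3` is `ℚ`-semialgebraic. [BCR1998 §2.2] -/
theorem isSemialgebraic_swapDom3 : IsSemialgebraic ℚ swapDom3 := by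
  have e : swapDom3 = (({u : Fin 3 → ℝ | 0 < MvPolynomial.aeval u (MvPolynomial.X 1 : MvPolynomial (Fin 3) ℚ)} ∩
      {u : Fin 3 → ℝ | 0 < MvPolynomial.aeval u (MvPolynomial.X 2 - MvPolynomial.X 1 : MvPolynomial (Fin 3) ℚ)}) ∩
      {u : Fin 3 → ℝ | 0 < MvPolynomial.aeval u (MvPolynomial.X 0 - MvPolynomial.X 2 : MvPolynomial (Fin 3) ℚ)}) ∩
      {u : Fin 3 → ℝ | 0 < MvPolynomial.aeval u (MvPolynomial.C 1 - MvPolynomial.X 0 : MvPolynomial (Fin 3) ℚ)} := by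
    ext u
    simp only [swapDom3, mem_setOf_eq, mem_inter_iff, map_sub, MvPolynomial.aeval_X, map_one, sub_pos]
    tauto
  rw [e]
  exact (((Literature.ModelTheory.ExponentialFields.isSemialgebraic_setOf_eval_pos (k := ℚ) _).inter
    (Literature.ModelTheory.ExponentialFields.isSemialgebraic_setOf_eval_pos (k := ℚ) _)).inter
    (Literature.ModelTheory.ExponentialFields.isSemialgebraic_setOf_eval_pos (k := ℚ) _)).inter
    (Literature.ModelTheory.ExponentialFields.isSemialgebraic_setOf_eval_pos (k := ℚ) _)

/-- `swapDom3` is measurable. [bookkeeping] -/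
theorem measurableSet_swapDom3 : MeasurableSet swapDom3 := IsSemialgebraic.measurableSet_holds isSemialgebraic_swapDom3

/-- Auxiliary step `isSemialgebraicMapOn_sw3`. [bookkeeping] -/
theorem isSemialgebraicMapOn_sw3 {A : Set (Fin 3 → ℝ)} (hA : IsSemialgebraic ℚ A) : IsSemialgebraicMapOn ℚ A sw3 :=
  (isSemialgebraicMapOn_aeval hA ![MvPolynomial.X 0, MvPolynomial.X 2, MvPolynomial.X 1]).congr fun z _ => by
    funext j
    fin_cases j <;> simp [sw3_zero, sw3_one, sw3_two]

/-- `F` integrable on `Δ₃` ⟹ `F ∘ sw` integrable on `Δ₃^sw` -/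
theorem integrableOn_comp_sw3 {F : (Fin 3 → ℝ) → ℝ} (hF : IntegrableOn F (KZ.openOrderedSimplex 3)) :
    IntegrableOn (fun u => F (sw3 u)) swapDom3 := by
  rw [← image_sw3'] at hF
  have h := (integrableOn_image_iff_integrableOn_abs_det_fderiv_smul (μ := volume) measurableSet_swapDom3
    (fun u _ => (hasFDerivAt_sw3 u).hasFDerivWithinAt) (fun a _ b _ hab => by
      have := congrArg sw3 hab; rwa [sw3_sw3, sw3_sw3] at this) F).1 hF
  refine h.congr_fun (fun u _ => ?_) measurableSet_swapDom3
  simp only [abs_det_sw3L, one_smul]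

/-- the swapped representation `sw^* r = [Δ₃^sw, r.integrand ∘ sw]` -/
noncomputable def swapRep3 (r : KZ.IntegralRep 3) (hd : r.domain = KZ.openOrderedSimplex 3) : KZ.IntegralRep 3 :=
  ⟨swapDom3, fun u => r.integrand (sw3 u), isSemialgebraic_swapDom3,
    IsSemialgebraicFunOn.comp_isSemialgebraicMapOn_holds (hd ▸ r.isSemialgebraicFunOn_integrand) (isSemialgebraicMapOn_sw3 isSemialgebraic_swapDom3)
      fun _ hu => sw3_mem' hu,
    integrableOn_comp_sw3 (hd ▸ r.integrableOn)⟩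

/-- Auxiliary step `swapRep3_domain`. [bookkeeping] -/
theorem swapRep3_domain (r : KZ.IntegralRep 3) (hd : r.domain = KZ.openOrderedSimplex 3) : (swapRep3 r hd).domain = swapDom3 := rfl

/-- Auxiliary step `swapRep3_integrand`. [bookkeeping] -/
theorem swapRep3_integrand (r : KZ.IntegralRep 3) (hd : r.domain = KZ.openOrderedSimplex 3) (u : Fin 3 → ℝ) :
    (swapRep3 r hd).integrand u = r.integrand (sw3 u) := rfl

/-- **the swap move** (rule 2): `[Δ₃, f] ≡ [Δ₃^sw, f ∘ sw]`. [Kontsevich–Zagier 2001 §1.2 rule (2)] -/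
theorem swap_move3 (r : KZ.IntegralRep 3) (hd : r.domain = KZ.openOrderedSimplex 3) :
    KZ.of r - KZ.of (swapRep3 r hd) ∈ KZ.relations := by
  have hΦsa : IsSemialgebraicMapOn ℚ r.domain sw3 := by rw [hd]; exact isSemialgebraicMapOn_sw3 (KZ.isSemialgebraic_openOrderedSimplex 3)
  have hder : ∀ x ∈ r.domain, HasFDerivWithinAt sw3 sw3L r.domain x := fun x _ => (hasFDerivAt_sw3 x).hasFDerivWithinAt
  have hinj : InjOn sw3 r.domain := fun a _ b _ hab => by
    have := congrArg sw3 hab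
    rwa [sw3_sw3, sw3_sw3] at this
  have hdom : (swapRep3 r hd).domain = sw3 '' r.domain := by rw [swapRep3_domain, hd, image_sw3]
  refine KZ.changeOfVariablesRel_subset_relations ⟨3, r, swapRep3 r hd, sw3, fun _ => sw3L, hΦsa, hder, hinj, hdom, fun z _ => ?_, rfl⟩
  show r.integrand z = r.integrand (sw3 (sw3 z)) * |sw3L.det|
  rw [abs_det_sw3L, mul_one, sw3_sw3]

/-- the closed band `u₁ ≤ u₂ ≤ u₀` over `Δ₂` -/
def bandC3 : Set (Fin 3 → ℝ) :=
  KZlog.band (KZ.openOrderedSimplex 2) (fun y : Fin 2 → ℝ => y 1) (fun y : Fin 2 → ℝ => y 0)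

/-- Membership in `bandC3_iff`, unfolded. [bookkeeping] -/
theorem mem_bandC3_iff (z : Fin 3 → ℝ) : z ∈ bandC3 ↔ (0 < z 1 ∧ z 1 < z 0 ∧ z 0 < 1) ∧ z 1 ≤ z 2 ∧ z 2 ≤ z 0 := by
  rw [bandC3, KZlog.mem_band, mem_simplex_two_iff]
  exact Iff.rfl

/-- Auxiliary step `bandC3_facts`. [bookkeeping] -/
theorem bandC3_facts {z : Fin 3 → ℝ} (hz : z ∈ bandC3) :
    z 0 ≠ 0 ∧ z 2 ≠ 0 ∧ (1 : ℝ) - z 2 ≠ 0 ∧ (1 : ℝ) - z 1 ≠ 0 ∧ z 0 - z 1 ≠ 0 := by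
  obtain ⟨⟨h1, h10, h0⟩, h12, h20⟩ := (mem_bandC3_iff z).1 hz
  exact ⟨by linarith, by linarith, by linarith, by linarith, by linarith⟩

/-- `bandC3` is `ℚ`-semialgebraic. [BCR1998 §2.2] -/
theorem isSemialgebraic_bandC3 : IsSemialgebraic ℚ bandC3 := by
  have hτ := KZ.isSemialgebraic_openOrderedSimplex 2
  exact KZlog.isSemialgebraic_band
    ((isSemialgebraicFunOn_aeval hτ (MvPolynomial.X 1 : MvPolynomial (Fin 2) ℚ)).congr fun y _ => by simp)
    ((isSemialgebraicFunOn_aeval hτ (MvPolynomial.X 0 : MvPolynomial (Fin 2) ℚ)).congr fun y _ => by simp)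

/-- Auxiliary step `swapDom3_eq_openBand`. [bookkeeping] -/
theorem swapDom3_eq_openBand : swapDom3 =
    {z : Fin 3 → ℝ | (Fin.init z : Fin 2 → ℝ) ∈ KZ.openOrderedSimplex 2 ∧ (fun y : Fin 2 → ℝ => y 1) (Fin.init z) < z (Fin.last 2) ∧
      z (Fin.last 2) < (fun y : Fin 2 → ℝ => y 0) (Fin.init z : Fin 2 → ℝ)} := by
  ext z
  simp only [swapDom3, mem_setOf_eq, mem_simplex_two_iff]
  rw [show (Fin.init z : Fin 2 → ℝ) 0 = z 0 from rfl, show (Fin.init z : Fin 2 → ℝ) 1 = z 1 from rfl,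
    show z (Fin.last 2) = z 2 from rfl]
  constructor
  · rintro ⟨h1, h12, h20, h0⟩; exact ⟨⟨h1, h12.trans h20, h0⟩, h12, h20⟩
  · rintro ⟨⟨h1, -, h0⟩, h12, h20⟩; exact ⟨h1, h12, h20, h0⟩

end SwapMoveThree

end Summit.KontsevichZagierPeriods.KontsevichZagierPeriods.Theorems.RootDecompZetaThreeFrontierWordMoves

namespace Summit.KontsevichZagierPeriods.RootDecompZetaThreeFrontier.WordLayer

open Set MeasureTheory Literature.NumberTheory.Transcendental
open Literature.ModelTheory.ExponentialFields (IsSemialgebraic)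
open Summit.KontsevichZagierPeriods.KontsevichZagierPeriods.Theorems.RootDecompZetaThreeFrontierWordMoves (swapDom3 bandC3 swapDom3_eq_openBand)
open Summit.KontsevichZagierPeriods.KontsevichZagierPeriods.Theorems.RootDecompZetaThreeFrontierWordMoves (mem_simplex_two_iff)

section NLC3

/-- **Newton–Leibniz on the swapped simplex**: integrate the last coordinate `u₂` from `u₁` to `u₀` over the base `Δ₂` -/
theorem nlC3 {f F : (Fin 3 → ℝ) → ℝ} (hf : IsSemialgebraicFunOn ℚ bandC3 f) (hF : IsSemialgebraicFunOn ℚ bandC3 F)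
    (hcont : ∀ y ∈ KZ.openOrderedSimplex 2, ContinuousOn (fun t => F (Fin.snoc y t)) (Icc (y 1) (y 0)))
    (hder : ∀ y ∈ KZ.openOrderedSimplex 2, ∀ t ∈ Ioo (y 1) (y 0),
      HasDerivAt (fun s => F (Fin.snoc y s)) (f (Fin.snoc y t)) t)
    (r : KZ.IntegralRep 3) (hd : r.domain = swapDom3) (hi : EqOn r.integrand f r.domain) :
    ∃ r' : KZ.IntegralRep 2, r'.domain = KZ.openOrderedSimplex 2 ∧
      (r'.integrand = fun y => F (Fin.snoc y (y 0)) - F (Fin.snoc y (y 1))) ∧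
      KZ.of r - KZ.of r' ∈ KZ.relations := by
  have hτ := KZ.isSemialgebraic_openOrderedSimplex 2
  have ha : IsSemialgebraicFunOn ℚ (KZ.openOrderedSimplex 2) (fun y : Fin 2 → ℝ => y 1) :=
    (isSemialgebraicFunOn_aeval hτ (MvPolynomial.X 1 : MvPolynomial (Fin 2) ℚ)).congr fun y _ => by simp
  have hb : IsSemialgebraicFunOn ℚ (KZ.openOrderedSimplex 2) (fun y : Fin 2 → ℝ => y 0) :=
    (isSemialgebraicFunOn_aeval hτ (MvPolynomial.X 0 : MvPolynomial (Fin 2) ℚ)).congr fun y _ => by simp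
  have hab : ∀ y ∈ KZ.openOrderedSimplex 2, (fun y : Fin 2 → ℝ => y 1) y < (fun y : Fin 2 → ℝ => y 0) y :=
    fun y hy => ((mem_simplex_two_iff y).1 hy).2.1
  exact newtonLeibniz_pack hτ ha hb hab hf hF hcont hder r (by rw [hd]; exact swapDom3_eq_openBand) hi

end NLC3

end Summit.KontsevichZagierPeriods.RootDecompZetaThreeFrontier.WordLayer

end
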